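/-
Copyright (c) 2026 the pub-hodgecm-mathlib formalisation cell (harness21).  Prover seat hodgecm-mathlib-K2E1-p11 (g2), Track B ∕ K2-LIT, h413 =
`stmt-HodgeConjecture-24833`, line `K2_E1_TraceFormulaBeta`, campaign «EIS-R7-BL-SPH-3» ∕ R8-LADDER-3, «MS-3» — THE OPERATOR-ROAD PAYER AT `N = 3`, PART (O3)₃ + ASSEMBLY₃
(dealer K2E1-plan (g6) deal (87) 2026-09-04T10:39:44Z): the `N = 3` PRINT of ★ p859407 `K2E1MaassSelbergFamilyPayerCMTwo` (K2E4-p11 (g5)) — the `L²(𝔛)`-holomorphic family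
`F z = [Λ^T Ẽ(z)]` of ★ socket p859379 `poleControl_continued_cm_three_of_family[_lower]` (K2E1-p13 (g0)) from the Bernstein–Lapid vector solution `vX` of `U(2,1)` through continuous
linear maps, HYPOTHESIS-FIRST on the high-cusp operator `K_T` ((O2)₃) and the constant-term ∕ smoothing commutation (★-track (S-β)).
-/
import Summits.HodgeConjecture.HodgeConjecture.Theorems.K2E1MaassSelbergFamilyPayerCMTwo        -- ★ p859407: §1 GLUE `exists_differentiableOn_of_local_ae_eq` ∕ `_of_local_operator_repr`, §2 (O1) `exists_lowPart_clm` (rank `N`) — CITED, not re-proved; brings ★ `𝓗_k(𝔛)` (`HX`), `supHeight` facts, `ae_withDensity_weightX_iff`, ★ `truncation_apply_eq_self_of_forall_borelHeight_le`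
import Literature.NumberTheory.Automorphic.UnitaryGroupTruncatedKernelHighCusp                  -- ★ `truncation_eq_self_sub_borelConstantTerm_of_rational_invariant` (high region, N = 3)
import HarnessLib

/-!
# h413 ∕ Track B «K2-LIT», «MS-3» — `K2E1MaassSelbergFamilyPayerCMThree`: THE OPERATOR ROAD AT `N = 3`, (O3)₃ + ASSEMBLY₃ — `[Λ^T Ẽ(z)] = ĥ(z)⁻¹ • (A_T (T_X (vX z)) + K_T (vX z))`
# in `L²(𝔛, μ)` for `U(2,1)`, hence `z ↦ [Λ^T Ẽ(z)]` is `L²`-HOLOMORPHIC wherever the Bernstein–Lapid vector `vX` is — the input `(F, hFd, hFtube)` of ★ socket p859379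

Cell `pub/hodgecm-mathlib`, crux H413 = `stmt-HodgeConjecture-24833`, route `HCCMUnconditional`; dealer K2E1-plan (g6) deal (87) («YOUR FILE BY NAME = the N = 3 PRINT of K2E4-p11's ★ p859407
operator-road payer»).  THEOREMS ONLY (no `def` ∕ `instance` ∕ `notation` ∕ named-fact hypothesis ∕ `sorry`; default heartbeats); lane `--kind proof --supports stmt-HodgeConjecture-24833
--as helper` (count-neutral; closes no socket).  The `N = 2` edition is ★ `K2E1MaassSelbergFamilyPayerCMTwo`; its §1 (GLUE, generic `Lp`) and §2 ((O1) the low cut-off `A_T`, rank `N`) are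
rank-free and are CITED from there by name — this file prints only the rank-dependent §3 ∕ §4 with `U(J₂) ↦ U(J₃)`.
THE MATHEMATICS [BernsteinLapid2019, §4 p. 10; MoeglinWaldspurger1995, I.2.13, IV.2.3].  Off the Godement tube `{Re z > 2}` the continued spherical Eisenstein series of `U(2,1)` is, pointwise
in `g`, `Ẽ(z)(g) = ĥ(z)⁻¹·∫ h(y)·ṽ_z(g y) dνG(y)` where `ṽ_z(g) = (vX z)[g⁻¹]` is the canonical lift of (a representative of) the Bernstein–Lapid vector `vX z ∈ 𝓗_k(𝔛) = L²(𝔛, w₁^{−2k}μ)`.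
Arthur's truncation in `F`-rank one splits along the cut-off `w₁(x) ≶ T` (`T ≥ 1`): on `{w₁ ≤ T}` no `G(F)`-translate is above the cut-off and `Λ^T Ẽ = Ẽ` (★ rank-generic
`truncation_apply_eq_self_of_forall_borelHeight_le`), whose descent is a.e. `ĥ⁻¹·T_X(vX z)`; on `{T < w₁}` a point is `x = [g⁻¹]` with `T < H(g)` and `Λ^T Ẽ(g) = Ẽ(g) − Ẽ_B(g)` (★ N = 3
`truncation_eq_self_sub_borelConstantTerm_of_rational_invariant`, Garrett §2.10 for `U(2,1)`), and `Ẽ_B = ĥ⁻¹·∫ h(y)·ṽ_B(· y)` by the constant-term ∕ right-convolution commutation (letter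
`hcomm` = ★-track (S-β)), so `Λ^T Ẽ(g) = ĥ⁻¹·∫ h(y)(ṽ − ṽ_B)(g y) dνG` — the transported high-cusp smoothing, which (O2)₃ realises as a bounded operator `K_T : 𝓗_k(𝔛) →L L²(μ)` (★ `hK1_cm_three`
decay + Siegel transport; here the letter `hK`).  With the low cut-off `A_T` (★ `exists_lowPart_clm`, rank `N`, PROVED) the class of `Λ^T Ẽ(z)` in `L²(μ)` is
`ĥ(z)⁻¹ • (A_T (T_X (vX z)) + K_T (vX z))`: continuous linear maps applied to the holomorphic `vX`, times a holomorphic scalar — holomorphic, with no pointwise majorant.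
* §3 `quotFun_truncation_ae_eq_of_repr_three` — (O3)₃, functions only: `quotFun (Λ^T φ) =ᵐ[μ] a·(𝟙_{w₁ ≤ T}·Tu + Ku)` from the pointwise representation `φ = a·R(h)ũ`, the `T_X` letter,
  the high-cusp letter `hKu`, `hcomm` and two integrability letters (bytes of ★ p859407 §3 with `c 2 ↦ c 3`).
* §4 `exists_family_of_operator_letters_three` — ASSEMBLY₃: `∃ F : ℂ → L²(μ)`, holomorphic on `D`, `F z =ᵐ quotFun (Λ^T (Ec z))` on `D` — the `(F, hFd, hFtube)` input of ★ p859379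
  `poleControl_continued_cm_three_of_family` (`D = D⁺`) ∕ `_lower` (`D = D⁻`) once `Ec z = E(φ₀H^z)` on the tube `{2 < Re z}` (bytes of ★ p859407 §4 with `c 2 ↦ c 3`).
* §5 `exists_family_of_operator_letters_three_lowPart` — the same with the low cut-off `A_T` DISCHARGED by ★ `exists_lowPart_clm k T μ` at `N = 3` (one letter fewer for the closer).
HONEST LABEL.  Count-neutral helper; proves no printed statement; (O2)₃ (`hK`), `hcomm`, `hint₁`, `hint₂`, `hrepr` are LETTERS; HC_CM is proved only modulo the 7 printed citations (2 remaining
named inputs: hLiu418 = `stmt-HodgeConjecture-24832`, h413 = `stmt-HodgeConjecture-24833`) until rung 0 closes.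

## References
* [BernsteinLapid2019] J. Bernstein, E. Lapid, *On the meromorphic continuation of Eisenstein series*, J. AMS 37 (2024), §4 p. 10 (Claims 4–5).
* [MoeglinWaldspurger1995] C. Mœglin, J.-L. Waldspurger, *Spectral decomposition and Eisenstein series* (1995), I.2.13, IV.2.3, IV.3.12 (a).
* [Garrett2018] P. Garrett, *Modern analysis of automorphic forms by example* (2018), §2.10–§2.11.
-/

set_option autoImplicit false
set_option linter.dupNamespace false  -- the mandated namespace repeats the summit's segment (`HodgeConjecture.HodgeConjecture`)

noncomputable section

open MeasureTheory Measure NumberField IsDedekindDomain Set Filter Topology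
open scoped ENNReal NNReal
open Literature.NumberTheory.Automorphic Literature.NumberTheory.Automorphic.UnitaryGroup AdelicGroupData
open Summit.HodgeConjecture.HodgeConjecture.Cruxes.H413.K2E1BLBorelSpacesU2Defs
open Summit.HodgeConjecture.HodgeConjecture.Cruxes.H413.K2E1BLHeckeOperatorWeightedU2 (bddAbove_range_borelHeight_arith_mul)
open Summit.HodgeConjecture.HodgeConjecture.Cruxes.H413.K2E1BLHeckeOperatorHXU2 (supHeight_toAutomorphicQuotient supHeight_pos measurable_supHeight measurable_weightX)
open Summit.HodgeConjecture.HodgeConjecture.Cruxes.H413.K2E1BLHeckeOperatorHXU2Op (ae_withDensity_weightX_iff eLpNorm_two_withDensity_weightX)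
open Summit.HodgeConjecture.HodgeConjecture.Cruxes.H413.K2E1TruncatedEisensteinL2 (truncation_apply_eq_self_of_forall_borelHeight_le)
open Summit.HodgeConjecture.HodgeConjecture.Cruxes.H413.K2E1MaassSelbergFamilyPayerCMTwo (exists_lowPart_clm)

namespace Summit.HodgeConjecture.HodgeConjecture.Cruxes.H413.K2E1MaassSelbergFamilyPayerCMThree

/-! ## §3 (O3)₃ The a.e. identity `quotFun (Λ^T φ) = a·(𝟙_{w₁ ≤ T}·Tu + Ku)` on `𝔛` (`N = 3`; functions only) -/

section Identity

variable {F E : Type} [Field F] [NumberField F] [Field E] [NumberField E] [Algebra F E] {c : E ≃ₐ[F] E}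

/-- A point of `𝔛 = G(F)\U(J₃)(𝔸_F)` is the class of the inverse of `δ·x̃⁻¹` for every `δ ∈ G(F)` (`x̃ = out x`): `[(δ·x̃⁻¹)⁻¹] = [x̃·δ⁻¹] = [x̃] = x`.
[cite: BernsteinLapid2019, §4 p. 10] -/
theorem toAutomorphicQuotient_inv_arith_mul_out_inv_three (x : (quasiSplit F E c 3).automorphicQuotient) (δ : (quasiSplit F E c 3).arithmeticSubgroup) :
    (quasiSplit F E c 3).toAutomorphicQuotient
        ((δ : (quasiSplit F E c 3).Adelic) * (Quotient.out (x : (quasiSplit F E c 3).Adelic ⧸ (quasiSplit F E c 3).quotientSubgroup))⁻¹)⁻¹ = x := by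
  have hx : (quasiSplit F E c 3).toAutomorphicQuotient (Quotient.out (x : (quasiSplit F E c 3).Adelic ⧸ (quasiSplit F E c 3).quotientSubgroup)) = x :=
    QuotientGroup.out_eq' _
  conv_rhs => rw [← hx]
  rw [_root_.mul_inv_rev, inv_inv]
  change (QuotientGroup.mk _ : (quasiSplit F E c 3).Adelic ⧸ (quasiSplit F E c 3).quotientSubgroup) = QuotientGroup.mk _
  rw [QuotientGroup.eq, _root_.mul_inv_rev, inv_inv, mul_assoc, inv_mul_cancel, mul_one, quotientSubgroup_quasiSplit]
  exact δ.2

variable [MeasurableSpace (quasiSplit F E c 3).Adelic] [BorelSpace (quasiSplit F E c 3).Adelic]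

/-- **(O3)₃ THE a.e. IDENTITY.**  `N = 3`, `ν` Haar on `N(𝔸)` of `U(J₃)` with fundamental domain `𝓕`, `1 ≤ T`; `φ` left-`G(F)`-invariant (`= Ẽ(z)`) with the pointwise representation
`φ g = a·∫ h(y)·ut(g y) dνG` through the canonical lift `ut g = U[g⁻¹]` of a function `U` on `𝔛` (`= vX z`, `a = ĥ(z)⁻¹`); `Tu =ᵐ ∫ h(y) U(y⁻¹•·) dνG` (the `T_X` letter); `Ku` vanishes a.e.
on `{w₁ ≤ T}` and is the transported high-cusp smoothing `∫ h(y)(ut − ut_B)(g y) dνG` at a.e. `x = [g⁻¹]` with `T < H(g)` (the (O2)₃ letter); `hcomm` = `(R(h)ut)_B(g) = ∫ h(y) ut_B(g y)`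
above the cut-off (★-track (S-β)); integrability of `h·ut(g·)`, `h·ut_B(g·)` there.  THEN `quotFun (Λ^T φ) =ᵐ[μ] a·(𝟙_{w₁ ≤ T}·Tu + Ku)`.  LOW: `w₁(x) ≤ T` bounds every `H(δ x̃⁻¹)`
(★ `supHeight_toAutomorphicQuotient`, `bddAbove_range_borelHeight_arith_mul`), so `Λ^T φ(x̃⁻¹) = φ(x̃⁻¹)` (★ low lemma, rank `N`) `= a·∫ h(y) U(y⁻¹•x)`; HIGH: `T < w₁(x)` produces `δ` with
`T < H(δ x̃⁻¹)`, `Λ^T φ` is `G(F)`-invariant (★ `truncation_rational_mul`) and `= φ − φ_B` there (★ N = 3 high lemma `truncation_eq_self_sub_borelConstantTerm_of_rational_invariant`),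
`φ_B = a·∫ h(y) ut_B(· y)` (★ `borelConstantTerm_smul`, `hcomm`).  The `N = 3` print of ★ `K2E1MaassSelbergFamilyPayerCMTwo.quotFun_truncation_ae_eq_of_repr`.
[cite: BernsteinLapid2019, §4 p. 10] [cite: MoeglinWaldspurger1995, I.2.13] [cite: Garrett2018, §2.10] -/
theorem quotFun_truncation_ae_eq_of_repr_three (ν : Measure (adelicUnipotent F E c 3)) [ν.IsHaarMeasure] {𝓕 : Set (adelicUnipotent F E c 3)}
    (h𝓕 : IsFundamentalDomain (rationalUnipotent F E c 3) 𝓕 ν) {T : ℝ≥0} (hT : 1 ≤ T)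
    (μ : Measure (quasiSplit F E c 3).automorphicQuotient) (νG : Measure (quasiSplit F E c 3).Adelic) (h : (quasiSplit F E c 3).Adelic → ℂ)
    {φ : (quasiSplit F E c 3).Adelic → ℂ} (hφ : ∀ γ : (quasiSplit F E c 3).arithmeticSubgroup, ∀ x : (quasiSplit F E c 3).Adelic, φ ((γ : (quasiSplit F E c 3).Adelic) * x) = φ x)
    (U : (quasiSplit F E c 3).automorphicQuotient → ℂ) {ut : (quasiSplit F E c 3).Adelic → ℂ} (hut : ∀ g, ut g = U ((quasiSplit F E c 3).toAutomorphicQuotient g⁻¹)) (a : ℂ)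
    (hrepr : ∀ g, φ g = a * ∫ y, h y * ut (g * y) ∂νG)
    {Tu : (quasiSplit F E c 3).automorphicQuotient → ℂ} (hTu : Tu =ᵐ[μ] fun ξ => ∫ y, h y * U (y⁻¹ • ξ) ∂νG)
    {Ku : (quasiSplit F E c 3).automorphicQuotient → ℂ}
    (hKu : ∀ᵐ x ∂μ, (supHeight F E c 3 x ≤ T → Ku x = 0) ∧
      ∀ g : (quasiSplit F E c 3).Adelic, (quasiSplit F E c 3).toAutomorphicQuotient g⁻¹ = x → T < borelHeight g →
        Ku x = ∫ y, h y * (ut (g * y) - borelConstantTerm ν 𝓕 ut (g * y)) ∂νG)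
    (hcomm : ∀ g : (quasiSplit F E c 3).Adelic, T < borelHeight g →
      borelConstantTerm ν 𝓕 (fun x => ∫ y, h y * ut (x * y) ∂νG) g = ∫ y, h y * borelConstantTerm ν 𝓕 ut (g * y) ∂νG)
    (hint₁ : ∀ g : (quasiSplit F E c 3).Adelic, T < borelHeight g → Integrable (fun y => h y * ut (g * y)) νG)
    (hint₂ : ∀ g : (quasiSplit F E c 3).Adelic, T < borelHeight g → Integrable (fun y => h y * borelConstantTerm ν 𝓕 ut (g * y)) νG) :
    (quasiSplit F E c 3).quotFun (truncation ν 𝓕 T φ) =ᵐ[μ] fun x => a * ({x | supHeight F E c 3 x ≤ T}.indicator Tu x + Ku x) := by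
  filter_upwards [hTu, hKu] with x hxT hxK
  -- the representative `x̃` and the height supremum at `x`
  set xo : (quasiSplit F E c 3).Adelic := Quotient.out (x : (quasiSplit F E c 3).Adelic ⧸ (quasiSplit F E c 3).quotientSubgroup) with hxodef
  have hx : (quasiSplit F E c 3).toAutomorphicQuotient xo = x := QuotientGroup.out_eq' _
  have hsup : supHeight F E c 3 x = ⨆ γ : (quasiSplit F E c 3).arithmeticSubgroup, borelHeight ((γ : (quasiSplit F E c 3).Adelic) * xo⁻¹) := by
    conv_lhs => rw [← hx]
    exact supHeight_toAutomorphicQuotient xo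
  have hq : (quasiSplit F E c 3).quotFun (truncation ν 𝓕 T φ) x = truncation ν 𝓕 T φ xo⁻¹ := rfl
  by_cases hle : supHeight F E c 3 x ≤ T
  · -- LOW: no translate above the cut-off
    have hall : ∀ δ : (quasiSplit F E c 3).arithmeticSubgroup, borelHeight ((δ : (quasiSplit F E c 3).Adelic) * xo⁻¹) ≤ T := fun δ =>
      (le_ciSup (bddAbove_range_borelHeight_arith_mul xo⁻¹) δ).trans (hsup ▸ hle)
    rw [hq, truncation_apply_eq_self_of_forall_borelHeight_le ν 𝓕 φ hall, hrepr, Set.indicator_of_mem (show x ∈ {x | supHeight F E c 3 x ≤ T} from hle), (hxK.1 hle), add_zero, hxT]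
    congr 1
    refine integral_congr_ae (Eventually.of_forall fun y => ?_)
    show h y * ut (xo⁻¹ * y) = h y * U (y⁻¹ • x)
    rw [hut, _root_.mul_inv_rev, inv_inv]
    congr 2
    rw [← hx]
    rfl
  · -- HIGH: `x = [g⁻¹]` with `T < H(g)`, `Λ^T φ(g) = φ(g) − φ_B(g)`
    have hlt : T < supHeight F E c 3 x := not_le.1 hle
    rw [hsup] at hlt
    obtain ⟨δ, hδ⟩ := exists_lt_of_lt_ciSup hlt
    set g : (quasiSplit F E c 3).Adelic := (δ : (quasiSplit F E c 3).Adelic) * xo⁻¹ with hgdef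
    have hgx : (quasiSplit F E c 3).toAutomorphicQuotient g⁻¹ = x := toAutomorphicQuotient_inv_arith_mul_out_inv_three x δ
    have hinv : truncation ν 𝓕 T φ xo⁻¹ = truncation ν 𝓕 T φ g := by
      have h1 : xo⁻¹ = ((δ⁻¹ : (quasiSplit F E c 3).arithmeticSubgroup) : (quasiSplit F E c 3).Adelic) * g := by
        rw [hgdef, Subgroup.coe_inv, inv_mul_cancel_left]
      rw [h1, truncation_rational_mul ν h𝓕 T hφ]
    have hφfun : φ = a • fun x => ∫ y, h y * ut (x * y) ∂νG := by
      funext g'; rw [Pi.smul_apply, smul_eq_mul]; exact hrepr g'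
    have hB : borelConstantTerm ν 𝓕 φ g = a * ∫ y, h y * borelConstantTerm ν 𝓕 ut (g * y) ∂νG := by
      rw [hφfun, borelConstantTerm_smul, hcomm g hδ]
    rw [hq, hinv, truncation_eq_self_sub_borelConstantTerm_of_rational_invariant ν h𝓕 hφ hT hδ, hB, hrepr g,
      Set.indicator_of_notMem (show x ∉ {x | supHeight F E c 3 x ≤ T} from hle), zero_add, hxK.2 g hgx hδ, ← mul_sub,
      ← integral_sub (hint₁ g hδ) (hint₂ g hδ)]
    congr 1
    refine integral_congr_ae (Eventually.of_forall fun y => ?_)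
    show h y * ut (g * y) - h y * borelConstantTerm ν 𝓕 ut (g * y) = h y * (ut (g * y) - borelConstantTerm ν 𝓕 ut (g * y))
    ring

end Identity

/-! ## §4 Assembly₃: the `L²(μ)`-holomorphic family `F z = ĥ(z)⁻¹ • (A_T (T_X (vX z)) + K_T (vX z))`, `F z =ᵐ quotFun (Λ^T (Ec z))` (`N = 3`) -/

section Assembly

variable {F E : Type} [Field F] [NumberField F] [Field E] [NumberField E] [Algebra F E] {c : E ≃ₐ[F] E}
variable [MeasurableSpace (quasiSplit F E c 3).Adelic] [BorelSpace (quasiSplit F E c 3).Adelic]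

/-- **ASSEMBLY₃: THE OPERATOR ROAD AT `N = 3`.**  `ν` Haar on `N(𝔸)` of `U(J₃)` with fundamental domain `𝓕`, `1 ≤ T`; `D ⊆ ℂ` (any set); `vX : ℂ → 𝓗_k(𝔛)` holomorphic on `D` (the
Bernstein–Lapid vector of `U(2,1)`); `ĥ` holomorphic and non-vanishing on `D`; the continued functions `Ec z` left-`G(F)`-invariant with the pointwise representation
`Ec z g = ĥ(z)⁻¹·∫ h(y)·(vX z)[(g y)⁻¹] dνG` on `D`; the `𝔛`-side smoothing operator `T_X` with its a.e. formula; the low cut-off `A_T` (★ `exists_lowPart_clm`, rank `N`); the high-cusp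
operator `K_T : 𝓗_k(𝔛) →L L²(μ)` with its a.e. description `hK` ((O2)₃); and, for `z ∈ D` above the cut-off, the commutation `hcomm` (★-track (S-β)) and two integrabilities.  THEN
`F z := ĥ(z)⁻¹ • (A_T (T_X (vX z)) + K_T (vX z))` is holomorphic on `D` and `F z =ᵐ[μ] quotFun (Λ^T (Ec z))` for `z ∈ D` — the input `(F, hFd, hFtube)` of ★
`poleControl_continued_cm_three_of_family` (`D = D⁺`) ∕ `poleControl_continued_cm_three_of_family_lower` (`D = D⁻`) as soon as `Ec z = E(φ₀H^z)` on the tube `{2 < Re z}`.  The `N = 3`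
print of ★ `K2E1MaassSelbergFamilyPayerCMTwo.exists_family_of_operator_letters`. [cite: BernsteinLapid2019, §4 p. 10] [cite: MoeglinWaldspurger1995, IV.2.3] -/
theorem exists_family_of_operator_letters_three (ν : Measure (adelicUnipotent F E c 3)) [ν.IsHaarMeasure] {𝓕 : Set (adelicUnipotent F E c 3)}
    (h𝓕 : IsFundamentalDomain (rationalUnipotent F E c 3) 𝓕 ν) {T : ℝ≥0} (hT : 1 ≤ T) (k : ℕ)
    (μ : Measure (quasiSplit F E c 3).automorphicQuotient) (νG : Measure (quasiSplit F E c 3).Adelic) (h : (quasiSplit F E c 3).Adelic → ℂ)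
    {D : Set ℂ} (vX : ℂ → HX F E c 3 k μ) (hvX : DifferentiableOn ℂ vX D)
    (ĥ : ℂ → ℂ) (hĥ : DifferentiableOn ℂ ĥ D) (hĥ0 : ∀ z ∈ D, ĥ z ≠ 0)
    (Ec : ℂ → (quasiSplit F E c 3).Adelic → ℂ)
    (hEcinv : ∀ z ∈ D, ∀ γ : (quasiSplit F E c 3).arithmeticSubgroup, ∀ x : (quasiSplit F E c 3).Adelic, Ec z ((γ : (quasiSplit F E c 3).Adelic) * x) = Ec z x)
    (hrepr : ∀ z ∈ D, ∀ g : (quasiSplit F E c 3).Adelic,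
      Ec z g = (ĥ z)⁻¹ * ∫ y, h y * ((vX z : HX F E c 3 k μ) : (quasiSplit F E c 3).automorphicQuotient → ℂ) ((quasiSplit F E c 3).toAutomorphicQuotient (g * y)⁻¹) ∂νG)
    (TX : HX F E c 3 k μ →L[ℂ] HX F E c 3 k μ)
    (hTX : ∀ u : HX F E c 3 k μ, ((TX u : HX F E c 3 k μ) : (quasiSplit F E c 3).automorphicQuotient → ℂ)
      =ᵐ[μ.withDensity fun x => (((supHeight F E c 3 x)⁻¹ ^ (2 * k) : ℝ≥0) : ℝ≥0∞)]
        fun ξ => ∫ y, h y * (u : (quasiSplit F E c 3).automorphicQuotient → ℂ) (y⁻¹ • ξ) ∂νG)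
    (A : HX F E c 3 k μ →L[ℂ] Lp ℂ 2 μ)
    (hA : ∀ u : HX F E c 3 k μ, ((A u : Lp ℂ 2 μ) : (quasiSplit F E c 3).automorphicQuotient → ℂ) =ᵐ[μ]
      {x | supHeight F E c 3 x ≤ T}.indicator (u : (quasiSplit F E c 3).automorphicQuotient → ℂ))
    (K : HX F E c 3 k μ →L[ℂ] Lp ℂ 2 μ)
    (hK : ∀ u : HX F E c 3 k μ, ∀ᵐ x ∂μ, (supHeight F E c 3 x ≤ T → ((K u : Lp ℂ 2 μ) : (quasiSplit F E c 3).automorphicQuotient → ℂ) x = 0) ∧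
      ∀ g : (quasiSplit F E c 3).Adelic, (quasiSplit F E c 3).toAutomorphicQuotient g⁻¹ = x → T < borelHeight g →
        ((K u : Lp ℂ 2 μ) : (quasiSplit F E c 3).automorphicQuotient → ℂ) x =
          ∫ y, h y * ((u : (quasiSplit F E c 3).automorphicQuotient → ℂ) ((quasiSplit F E c 3).toAutomorphicQuotient (g * y)⁻¹) -
            borelConstantTerm ν 𝓕 (fun g' => (u : (quasiSplit F E c 3).automorphicQuotient → ℂ) ((quasiSplit F E c 3).toAutomorphicQuotient g'⁻¹)) (g * y)) ∂νG)
    (hcomm : ∀ z ∈ D, ∀ g : (quasiSplit F E c 3).Adelic, T < borelHeight g →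
      borelConstantTerm ν 𝓕 (fun x => ∫ y, h y * ((vX z : HX F E c 3 k μ) : (quasiSplit F E c 3).automorphicQuotient → ℂ) ((quasiSplit F E c 3).toAutomorphicQuotient (x * y)⁻¹) ∂νG) g =
        ∫ y, h y * borelConstantTerm ν 𝓕 (fun g' => ((vX z : HX F E c 3 k μ) : (quasiSplit F E c 3).automorphicQuotient → ℂ) ((quasiSplit F E c 3).toAutomorphicQuotient g'⁻¹)) (g * y) ∂νG)
    (hint₁ : ∀ z ∈ D, ∀ g : (quasiSplit F E c 3).Adelic, T < borelHeight g →
      Integrable (fun y => h y * ((vX z : HX F E c 3 k μ) : (quasiSplit F E c 3).automorphicQuotient → ℂ) ((quasiSplit F E c 3).toAutomorphicQuotient (g * y)⁻¹)) νG)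
    (hint₂ : ∀ z ∈ D, ∀ g : (quasiSplit F E c 3).Adelic, T < borelHeight g →
      Integrable (fun y => h y * borelConstantTerm ν 𝓕 (fun g' => ((vX z : HX F E c 3 k μ) : (quasiSplit F E c 3).automorphicQuotient → ℂ) ((quasiSplit F E c 3).toAutomorphicQuotient g'⁻¹)) (g * y)) νG) :
    ∃ Fam : ℂ → Lp ℂ 2 μ, DifferentiableOn ℂ Fam D ∧
      ∀ z ∈ D, ((Fam z : Lp ℂ 2 μ) : (quasiSplit F E c 3).automorphicQuotient → ℂ) =ᵐ[μ] (quasiSplit F E c 3).quotFun (truncation ν 𝓕 T (Ec z)) := by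
  refine ⟨fun z => (ĥ z)⁻¹ • ((A.comp TX + K) (vX z)), (hĥ.inv hĥ0).smul ((A.comp TX + K).differentiable.comp_differentiableOn hvX), fun z hz => ?_⟩
  -- §3 at `z`, with `U := vX z`, `ut` its canonical lift, `a := ĥ(z)⁻¹`, `Tu := T_X (vX z)`, `Ku := K_T (vX z)`
  have h3 := quotFun_truncation_ae_eq_of_repr_three ν h𝓕 hT μ νG h (hEcinv z hz) ((vX z : HX F E c 3 k μ) : (quasiSplit F E c 3).automorphicQuotient → ℂ)
    (ut := fun g => ((vX z : HX F E c 3 k μ) : (quasiSplit F E c 3).automorphicQuotient → ℂ) ((quasiSplit F E c 3).toAutomorphicQuotient g⁻¹)) (fun _ => rfl) (ĥ z)⁻¹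
    (hrepr z hz) ((ae_withDensity_weightX_iff μ k).1 (hTX (vX z))) (hK (vX z)) (hcomm z hz) (hint₁ z hz) (hint₂ z hz)
  have hsm := Lp.coeFn_smul (ĥ z)⁻¹ ((A.comp TX + K) (vX z))
  have hadd := Lp.coeFn_add (A (TX (vX z))) (K (vX z))
  filter_upwards [h3, hsm, hadd, hA (TX (vX z))] with x hx hxs hxa hxA
  rw [hx, hxs, Pi.smul_apply, smul_eq_mul, FunLike.coe_add, Pi.add_apply, ContinuousLinearMap.comp_apply, hxa, Pi.add_apply, hxA]

/-! ## §5 Assembly₃ with the low cut-off discharged (★ `exists_lowPart_clm`, rank `N`, at `N = 3`) -/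

/-- **ASSEMBLY₃, LOW CUT-OFF DISCHARGED.**  As `exists_family_of_operator_letters_three`, but the low cut-off operator `A_T : 𝓗_k(𝔛) →L[ℂ] L²(𝔛, μ)`, `A_T u =ᵐ 𝟙_{w₁ ≤ T}·u`, is SUPPLIED by
★ `K2E1MaassSelbergFamilyPayerCMTwo.exists_lowPart_clm k T μ` (rank-generic, PROVED there) — so the closer's only operator letters are `T_X` (★ `exists_shiftOperatorX`) and the high-cusp
`K_T` ((O2)₃). [cite: BernsteinLapid2019, §4 p. 10] [cite: MoeglinWaldspurger1995, IV.2.3] -/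
theorem exists_family_of_operator_letters_three_lowPart (ν : Measure (adelicUnipotent F E c 3)) [ν.IsHaarMeasure] {𝓕 : Set (adelicUnipotent F E c 3)}
    (h𝓕 : IsFundamentalDomain (rationalUnipotent F E c 3) 𝓕 ν) {T : ℝ≥0} (hT : 1 ≤ T) (k : ℕ)
    (μ : Measure (quasiSplit F E c 3).automorphicQuotient) (νG : Measure (quasiSplit F E c 3).Adelic) (h : (quasiSplit F E c 3).Adelic → ℂ)
    {D : Set ℂ} (vX : ℂ → HX F E c 3 k μ) (hvX : DifferentiableOn ℂ vX D)
    (ĥ : ℂ → ℂ) (hĥ : DifferentiableOn ℂ ĥ D) (hĥ0 : ∀ z ∈ D, ĥ z ≠ 0)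
    (Ec : ℂ → (quasiSplit F E c 3).Adelic → ℂ)
    (hEcinv : ∀ z ∈ D, ∀ γ : (quasiSplit F E c 3).arithmeticSubgroup, ∀ x : (quasiSplit F E c 3).Adelic, Ec z ((γ : (quasiSplit F E c 3).Adelic) * x) = Ec z x)
    (hrepr : ∀ z ∈ D, ∀ g : (quasiSplit F E c 3).Adelic,
      Ec z g = (ĥ z)⁻¹ * ∫ y, h y * ((vX z : HX F E c 3 k μ) : (quasiSplit F E c 3).automorphicQuotient → ℂ) ((quasiSplit F E c 3).toAutomorphicQuotient (g * y)⁻¹) ∂νG)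
    (TX : HX F E c 3 k μ →L[ℂ] HX F E c 3 k μ)
    (hTX : ∀ u : HX F E c 3 k μ, ((TX u : HX F E c 3 k μ) : (quasiSplit F E c 3).automorphicQuotient → ℂ)
      =ᵐ[μ.withDensity fun x => (((supHeight F E c 3 x)⁻¹ ^ (2 * k) : ℝ≥0) : ℝ≥0∞)]
        fun ξ => ∫ y, h y * (u : (quasiSplit F E c 3).automorphicQuotient → ℂ) (y⁻¹ • ξ) ∂νG)
    (K : HX F E c 3 k μ →L[ℂ] Lp ℂ 2 μ)
    (hK : ∀ u : HX F E c 3 k μ, ∀ᵐ x ∂μ, (supHeight F E c 3 x ≤ T → ((K u : Lp ℂ 2 μ) : (quasiSplit F E c 3).automorphicQuotient → ℂ) x = 0) ∧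
      ∀ g : (quasiSplit F E c 3).Adelic, (quasiSplit F E c 3).toAutomorphicQuotient g⁻¹ = x → T < borelHeight g →
        ((K u : Lp ℂ 2 μ) : (quasiSplit F E c 3).automorphicQuotient → ℂ) x =
          ∫ y, h y * ((u : (quasiSplit F E c 3).automorphicQuotient → ℂ) ((quasiSplit F E c 3).toAutomorphicQuotient (g * y)⁻¹) -
            borelConstantTerm ν 𝓕 (fun g' => (u : (quasiSplit F E c 3).automorphicQuotient → ℂ) ((quasiSplit F E c 3).toAutomorphicQuotient g'⁻¹)) (g * y)) ∂νG)
    (hcomm : ∀ z ∈ D, ∀ g : (quasiSplit F E c 3).Adelic, T < borelHeight g →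
      borelConstantTerm ν 𝓕 (fun x => ∫ y, h y * ((vX z : HX F E c 3 k μ) : (quasiSplit F E c 3).automorphicQuotient → ℂ) ((quasiSplit F E c 3).toAutomorphicQuotient (x * y)⁻¹) ∂νG) g =
        ∫ y, h y * borelConstantTerm ν 𝓕 (fun g' => ((vX z : HX F E c 3 k μ) : (quasiSplit F E c 3).automorphicQuotient → ℂ) ((quasiSplit F E c 3).toAutomorphicQuotient g'⁻¹)) (g * y) ∂νG)
    (hint₁ : ∀ z ∈ D, ∀ g : (quasiSplit F E c 3).Adelic, T < borelHeight g →
      Integrable (fun y => h y * ((vX z : HX F E c 3 k μ) : (quasiSplit F E c 3).automorphicQuotient → ℂ) ((quasiSplit F E c 3).toAutomorphicQuotient (g * y)⁻¹)) νG)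
    (hint₂ : ∀ z ∈ D, ∀ g : (quasiSplit F E c 3).Adelic, T < borelHeight g →
      Integrable (fun y => h y * borelConstantTerm ν 𝓕 (fun g' => ((vX z : HX F E c 3 k μ) : (quasiSplit F E c 3).automorphicQuotient → ℂ) ((quasiSplit F E c 3).toAutomorphicQuotient g'⁻¹)) (g * y)) νG) :
    ∃ Fam : ℂ → Lp ℂ 2 μ, DifferentiableOn ℂ Fam D ∧
      ∀ z ∈ D, ((Fam z : Lp ℂ 2 μ) : (quasiSplit F E c 3).automorphicQuotient → ℂ) =ᵐ[μ] (quasiSplit F E c 3).quotFun (truncation ν 𝓕 T (Ec z)) := by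
  obtain ⟨A, hA, -⟩ := exists_lowPart_clm (F := F) (E := E) (c := c) (N := 3) k T μ
  exact exists_family_of_operator_letters_three ν h𝓕 hT k μ νG h vX hvX ĥ hĥ hĥ0 Ec hEcinv hrepr TX hTX A hA K hK hcomm hint₁ hint₂

end Assembly

end Summit.HodgeConjecture.HodgeConjecture.Cruxes.H413.K2E1MaassSelbergFamilyPayerCMThree

end
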